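import Mathlib

set_option linter.dupNamespace false
set_option linter.unusedSectionVars false

/-!
# LevelRankA (lens 4, g29; (P7)(v) of the (c0) road) — A SUBSPACE OF SPARSE DUAL VECTORS FORCES LOW RANK

Blocker `X = AbsorptionDial.NoPerfectPolyOdd` (item 28487); decomp-qadv lens 4, g29.  On the NON-dispersing branch, `PairLawA.nonDisperse_levelSet`
makes a level set `Ξ_h = {ξ : #{i : ξ·c_i ≠ 0} ≤ h}` of the cross forms `c_i ∈ 𝔽_p^K` dense; Sanders' Bogolyubov–Ruzsa lemma [arXiv:1011.0107, Thm 20]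
(a Literature fact to be typed) then puts a subspace `Y` of small codimension inside `Ξ_{4h}`.  This file is step (v) of REFEREE-66v65 (P7): such a
subspace forces the matrix of the `c_i` to have rank `≤ codim Y + 2·(4h)` — the input format of `InnerDegreeLawsK.offDiag_lowRank` ((P8), landed).

* `card_filter_zero_le` (a functional `ξ ↦ ξ·v` not identically zero on `Y` vanishes on at most half of `Y`: translate by a witness);
* ★ `exists_exceptional` (if every `ξ ∈ Y` has `ξ·c_i ≠ 0` for at most `s` indices, then all but `≤ 2s` of the `c_i` are orthogonal to `Y` —
  double counting `Σ_{ξ∈Y} #{i} = Σ_i #{ξ}`); (the referee's sharper `s·p/(p−1)` needs exact fibre counts; `2s` suffices downstream);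
* ★★ `rank_le_of_sparse_subspace` (`rank (c) ≤ 2s + (K − dim Y)`: the non-exceptional rows lie in the dot-product orthogonal of `Y`, of dimension
  `K − dim Y` by `LinearMap.BilinForm.finrank_orthogonal` for the nondegenerate form `Matrix.toBilin' 1`).

Supports stmt-QuantumAdvantage-28487 (record; the residual `X` is NOT claimed).
-/

open Finset Module

namespace Summit.QuantumAdvantage.QuantumAdvantage.Theorems.LevelRank

variable {p : ℕ} [Fact p.Prime] {K : ℕ} {ι : Type*} [Fintype ι] [DecidableEq ι]

/-- a functional `ξ ↦ ξ·v` that is non-zero somewhere on `Y` vanishes on at most as many points of `Y` as it does not -/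
theorem card_filter_zero_le (Yf : Finset (Fin K → ZMod p)) (hY : ∀ ξ ∈ Yf, ∀ ξ' ∈ Yf, ξ + ξ' ∈ Yf) (v ξ₀ : Fin K → ZMod p)
    (hξ₀ : ξ₀ ∈ Yf) (hne : ξ₀ ⬝ᵥ v ≠ 0) :
    (Yf.filter fun ξ => ¬ (ξ ⬝ᵥ v ≠ 0)).card ≤ (Yf.filter fun ξ => ξ ⬝ᵥ v ≠ 0).card := by
  refine card_le_card_of_injOn (fun ξ => ξ + ξ₀) ?_ ?_
  · intro ξ hξ
    rw [mem_coe, mem_filter] at hξ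
    rw [mem_coe, mem_filter]
    refine ⟨hY ξ hξ.1 ξ₀ hξ₀, ?_⟩
    have h0 : ξ ⬝ᵥ v = 0 := by
      by_contra h
      exact hξ.2 h
    rw [add_dotProduct, h0, zero_add]
    exact hne
  · intro a _ b _ h
    exact add_right_cancel h

/-- **all but `≤ 2s` forms are orthogonal to `Y`.**  If every `ξ ∈ Y` pairs non-trivially with at most `s` of the `c_i`, then outside an
exceptional set of at most `2s` indices every `c_i` is orthogonal to all of `Y`. -/
theorem exists_exceptional (Y : Submodule (ZMod p) (Fin K → ZMod p)) (c : ι → Fin K → ZMod p) (s : ℕ)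
    (hY : ∀ ξ ∈ Y, (univ.filter fun i => ξ ⬝ᵥ c i ≠ 0).card ≤ s) :
    ∃ X : Finset ι, X.card ≤ 2 * s ∧ ∀ i ∉ X, ∀ ξ ∈ Y, ξ ⬝ᵥ c i = 0 := by
  classical
  set Yf : Finset (Fin K → ZMod p) := univ.filter (fun ξ => ξ ∈ Y) with hYf
  have hYmem : ∀ ξ, ξ ∈ Yf ↔ ξ ∈ Y := fun ξ => by simp [hYf]
  set X : Finset ι := univ.filter (fun i => ∃ ξ ∈ Y, ξ ⬝ᵥ c i ≠ 0) with hX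
  refine ⟨X, ?_, fun i hi ξ hξ => ?_⟩
  swap
  · by_contra hne
    exact hi (mem_filter.mpr ⟨mem_univ _, ξ, hξ, hne⟩)
  -- double counting
  have hD : ∑ ξ ∈ Yf, (univ.filter fun i => ξ ⬝ᵥ c i ≠ 0).card = ∑ i, (Yf.filter fun ξ => ξ ⬝ᵥ c i ≠ 0).card := by
    simp_rw [card_filter]
    rw [sum_comm]
  have hup : ∑ ξ ∈ Yf, (univ.filter fun i => ξ ⬝ᵥ c i ≠ 0).card ≤ Yf.card * s := by
    have h := sum_le_card_nsmul Yf (fun ξ => (univ.filter fun i => ξ ⬝ᵥ c i ≠ 0).card) s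
      (fun ξ hξ => hY ξ ((hYmem ξ).mp hξ))
    simpa using h
  have hlow : ∀ i ∈ X, Yf.card ≤ 2 * (Yf.filter fun ξ => ξ ⬝ᵥ c i ≠ 0).card := by
    intro i hi
    obtain ⟨ξ₀, hξ₀, hne⟩ := (mem_filter.mp hi).2
    have hsplit := card_filter_add_card_filter_not (s := Yf) (fun ξ => ξ ⬝ᵥ c i ≠ 0)
    have hle := card_filter_zero_le Yf (fun ξ hξ ξ' hξ' => (hYmem _).mpr (Y.add_mem ((hYmem ξ).mp hξ) ((hYmem ξ').mp hξ')))
      (c i) ξ₀ ((hYmem ξ₀).mpr hξ₀) hne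
    omega
  have hYpos : 0 < Yf.card := card_pos.mpr ⟨0, (hYmem 0).mpr Y.zero_mem⟩
  have h1 : X.card * Yf.card ≤ 2 * ∑ i, (Yf.filter fun ξ => ξ ⬝ᵥ c i ≠ 0).card := by
    calc X.card * Yf.card = ∑ i ∈ X, Yf.card := by rw [sum_const, smul_eq_mul]
      _ ≤ ∑ i ∈ X, 2 * (Yf.filter fun ξ => ξ ⬝ᵥ c i ≠ 0).card := sum_le_sum hlow
      _ = 2 * ∑ i ∈ X, (Yf.filter fun ξ => ξ ⬝ᵥ c i ≠ 0).card := by rw [mul_sum]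
      _ ≤ 2 * ∑ i, (Yf.filter fun ξ => ξ ⬝ᵥ c i ≠ 0).card :=
          Nat.mul_le_mul_left _ (sum_le_sum_of_subset_of_nonneg (subset_univ X) fun _ _ _ => Nat.zero_le _)
  rw [← hD] at h1
  have h2 : X.card * Yf.card ≤ 2 * s * Yf.card := by nlinarith
  exact Nat.le_of_mul_le_mul_right h2 hYpos

/-- **(P7)(v) — LOW RANK FROM A SUBSPACE OF SPARSE DUAL VECTORS.**  If a subspace `Y ≤ 𝔽_p^K` consists of vectors each pairing non-trivially
with at most `s` of the forms `c_i`, then the matrix with rows `c_i` has rank `≤ 2s + (K − dim Y)`. -/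
theorem rank_le_of_sparse_subspace (Y : Submodule (ZMod p) (Fin K → ZMod p)) (c : ι → Fin K → ZMod p) (s : ℕ)
    (hY : ∀ ξ ∈ Y, (univ.filter fun i => ξ ⬝ᵥ c i ≠ 0).card ≤ s) :
    (Matrix.of c).rank ≤ 2 * s + (K - finrank (ZMod p) Y) := by
  classical
  obtain ⟨X, hX, horth⟩ := exists_exceptional Y c s hY
  set B := Matrix.toBilin' (1 : Matrix (Fin K) (Fin K) (ZMod p)) with hB
  have hBnd : B.Nondegenerate :=
    LinearMap.BilinForm.nondegenerate_toBilin'_iff_det_ne_zero.mpr (by simp)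
  have hO : finrank (ZMod p) (B.orthogonal Y) = K - finrank (ZMod p) Y := by
    rw [LinearMap.BilinForm.finrank_orthogonal hBnd, finrank_fintype_fun_eq_card, Fintype.card_fin]
  rw [Matrix.rank_eq_finrank_span_row]
  have hspan : Submodule.span (ZMod p) (Set.range (Matrix.of c).row)
      ≤ Submodule.span (ZMod p) ((X.image c : Finset (Fin K → ZMod p)) : Set (Fin K → ZMod p)) ⊔ B.orthogonal Y := by
    rw [Submodule.span_le]
    rintro _ ⟨i, rfl⟩
    rw [Matrix.row_apply']
    by_cases hi : i ∈ X
    · refine Submodule.mem_sup_left (Submodule.subset_span ?_)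
      rw [coe_image]
      exact ⟨i, mem_coe.mpr hi, rfl⟩
    · refine Submodule.mem_sup_right ?_
      rw [LinearMap.BilinForm.mem_orthogonal_iff]
      intro ξ hξ
      rw [hB, Matrix.toBilin'_apply', Matrix.one_mulVec]
      exact horth i hi ξ hξ
  calc finrank (ZMod p) (Submodule.span (ZMod p) (Set.range (Matrix.of c).row))
      ≤ finrank (ZMod p) ↥(Submodule.span (ZMod p) ((X.image c : Finset (Fin K → ZMod p)) : Set (Fin K → ZMod p)) ⊔ B.orthogonal Y) :=
        Submodule.finrank_mono hspan
    _ ≤ finrank (ZMod p) (Submodule.span (ZMod p) ((X.image c : Finset (Fin K → ZMod p)) : Set (Fin K → ZMod p)))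
          + finrank (ZMod p) (B.orthogonal Y) := Submodule.finrank_add_le_finrank_add_finrank _ _
    _ ≤ X.card + (K - finrank (ZMod p) Y) := by
        have h1 := finrank_span_finset_le_card (R := ZMod p) (X.image c)
        have h2 : (X.image c).card ≤ X.card := card_image_le
        have h3 : finrank (ZMod p) (Submodule.span (ZMod p) ((X.image c : Finset (Fin K → ZMod p)) : Set (Fin K → ZMod p)))
            ≤ X.card := h1.trans h2
        omega
    _ ≤ 2 * s + (K - finrank (ZMod p) Y) := by omega

end Summit.QuantumAdvantage.QuantumAdvantage.Theorems.LevelRank
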